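import Literature.MathematicalPhysics.QuantumLattice.QuaternionSpinGaugeGroup
import Literature.MathematicalPhysics.QuantumLattice.GaugedHubbardTorus
import Literature.MathematicalPhysics.QuantumLattice.BdGBondHamiltonianTorus
import HarnessLib

/-!
# The Hubbard torus with its electron SPIN minimally coupled to a finite lattice gauge field

Topic `MathematicalPhysics/QuantumLattice` (family `hubbard`); definition request
`defn-spinGaugedHubbardTorus` of route `HubbardSuperconductivity/ColourTheSpin`, part 2 of 3 (part 1:
`QuaternionSpinGaugeGroup`, the coded group `Q8` and its spin-½ representation `Q8.rep`; part 3: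
the local gauge transformations, the Gauss law and the Elitzur lemma). The companion of
`GaugedHubbardTorus.lean` (charge `U(1)`, electric-flux basis): here a FINITE subgroup `G ⊂ SU(2)`
with a two-dimensional unitary representation `ρ : G →* Mat₂(ℂ)` acts on the electron spin, and the
Kogut–Susskind gauge field on the oriented bonds `b = (x, i)` of `(ℤ/Lℤ)²` is written in the
GROUP-ELEMENT (holonomy) basis `|u⟩`, `u : Bond L → G` (Kogut–Susskind 1975; Bietenholz–Wiese (2025)
§11.8, eqs. (11.56), (11.62)–(11.64)):

* basis states `SpinGauged.Index L G = (occupation configurations of hubbardTorus 2 L) × (Bond L → G)`;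
  operators are matrices, tensor products are Kronecker products `⊗ₖ`, link operators are
  matrices on `Bond L → G` (diagonal = functions of the link variables);
* `spinGaugedHubbardTorusWith ρ L U gE gB =`
  `-Σ_{b=(x,i)} Σ_{σ,τ} (c†_{xσ} c_{x+eᵢ,τ} ⊗ ρ(u_b)_{στ} + h.c.) + U Σ_x n_{x↑}n_{x↓} ⊗ 1`
  `+ gE · 1 ⊗ Σ_b E_b + gB · 1 ⊗ Σ_p (1 - ½ tr ρ(hol_p))`, where
  `E_b = 1 - (averaging of the link variable u_b over G)` is the projector onto the link functions
  orthogonal to the constants in `u_b` — the kinetic energy `|G|⁻¹ Σ_{h∈G} (1 - L_h)` of the complete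
  Cayley graph of `G`, the finite-group stand-in for the Laplacian on the group manifold
  (Bietenholz–Wiese eq. (11.60)); and `hol_p = u_{(x,0)} u_{(x+e₀,1)} u_{(x+e₁,0)}⁻¹ u_{(x,1)}⁻¹` is
  the plaquette holonomy (eq. (11.62): `Tr(1 - ½ U_p - ½ U_p†) = 2 (1 - ½ Re tr U_p)`; for
  `G ⊂ SU(2)` the characters are real);
* the physical one-parameter family of the route, `spinGaugedHubbardTorus L U g =`
  `spinGaugedHubbardTorusWith Q8.rep L U (g²) (1/g²)` for the quaternion group `Q₈` — DEFINITIONALLY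
  the `let H` inlined in the items `SgCorridorOrder`, `SgEndpoint`, `SgAnchorOrder`,
  `SgHoppingDictionary` (`spinGaugedHubbardTorus_eq_inline`, by `rfl`);
* the gauge-invariant (transported) `B₁g` singlet pair field
  `spinGaugedPairFieldWith ρ L = Σ_{b=(x,i)} g_d(i) Σ_{σ,τ} (ε ρ(u_b))_{στ} c_{xσ} c_{x+eᵢ,τ} ⊗ |u⟩⟨u|`,
  `g_d = (+1, -1)`, `ε = [[0,1],[-1,0]]`, and `spinGaugedPairField L` for `Q₈` — DEFINITIONALLY the
  route's `let P` (`spinGaugedPairField_eq_inline`, `rfl`);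
* the particle-number blocks `SpinGauged.HasParticleNumber N` (the route's `let p`).

## API (all proved)

Hermiticity for every `ρ` with real characters (`isHermitian_spinGaugedHubbardTorusWith`), in
particular for `Q₈` (`isHermitian_spinGaugedHubbardTorus`); `E_b` is a real symmetric idempotent;
the TRIVIAL-LINK DICTIONARY: at the flat configuration `u ≡ 1` the diagonal link block of `H` is
`hubbardTorus 2 L 1 U + gE |Bond L| (1 - |G|⁻¹)` for `L ≥ 3`
(`spinGaugedHubbardTorusWith_apply_one_one`; for `Q₈`: `+ (7/8) g² |Bond L|`,
`spinGaugedHubbardTorus_apply_one_one` — literally route item `SgHoppingDictionary`), and the pair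
field block is the summit's `pairField dWaveFormFactor L / √2` for every `L ≥ 1` and every `ρ`
(`spinGaugedPairFieldWith_apply_one_one`, `spinGaugedPairField_apply_one_one` — route item
`SgPairDictionary`).

## Degenerate sides, junk values

`L ≥ 1` (`[NeZero L]`); for `L = 2` the two bonds `(x,i)`, `(x+eᵢ,i)` join the same sites (double
edges absent from `fermionTorusGraph`, hence `L ≥ 3` in the hopping dictionary), for `L = 1` bonds
are loops. `spinGaugedHubbardTorus L U 0` carries Lean's `1/0 = 0`: no magnetic term.

## What is NOT here

The local gauge unitaries `W_y(h) = Γ_y(ρ(h)) ⊗ (u_{(y,i)} ↦ h u, u_{(y-eᵢ,i)} ↦ u h⁻¹)`, the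
Gauss-law subspace, `[H, W_y(h)] = 0`, gauge invariance of the pair field and the Hamiltonian
Elitzur lemma: part 3 (`SpinGaugeTransformations`). The `g → 0` flat-connection reduction and the
confined `g → ∞` effective model are route items, not literature.

## Sources

J. Kogut, L. Susskind, Phys. Rev. D 11 (1975) 395 (Hamiltonian lattice gauge theory with fermions);
W. Bietenholz, U.-J. Wiese, *Uncovering Quantum Field Theory and the Standard Model* (CUP 2025)
§11.8, eqs. (11.56), (11.60), (11.62)–(11.64); E. Fradkin, S. Shenker, Phys. Rev. D 19 (1979) 3682
(gauge–matter systems, unitary gauge); D. J. Scalapino, Phys. Rep. 250 (1995) 329, §2 (the `d`-wave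
pair field). The finite-group electric term `1 - P_const` is the route's specification
(`defn-spinGaugedHubbardTorus`).

## Mathlib / tree search

Mathlib: `Matrix.kroneckerMap` (`⊗ₖ`), `Matrix.diagonal`, `Function.update`, `Matrix.IsHermitian`;
no lattice gauge theory. Tree (REUSED): `GaugedHubbard.Bond`, `FermionTorus.shift`,
`GaugedHubbard.isHermitian_kronecker/real_smul/sum_numberOp_mul` (`GaugedHubbardTorus`), `creation`,
`annihilation`, `numberOp`, `hubbardTorus`, `FermionTorus.sum_shift_add_sum_shift_swap`
(`SpinTwistedHubbardTorus`), `pairField_dWaveFormFactor_eq`, `torusBondPair`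
(`BdGBondHamiltonianTorus`), `Q8`, `Q8.rep` (`QuaternionSpinGaugeGroup`).
-/

noncomputable section

namespace Literature.MathematicalPhysics.QuantumLattice

open Matrix Finset GaugedHubbard Literature.Probability.LatticeModels
open scoped Kronecker

namespace SpinGauged

/-! ### Basis states and link operators -/

section Links

variable {G : Type*}

/-- Basis states of the spin-gauged system: an occupation configuration of the `2L²` spin-orbitals
times a link configuration `u : Bond L → G` (group-element basis of the gauge field).
Kogut–Susskind (1975); Bietenholz–Wiese (2025) §11.8. [folklore] -/
abbrev Index (L : ℕ) (G : Type*) : Type _ :=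
  Finset (Orb (FermionTorus 2 L)) × (Bond L → G)

variable (L : ℕ)

/-- Decidable equality of basis states, assembled from the two factors (as for
`GaugedHubbard.Index`: the default search succeeds but its term is large; `Decidable` instances are
subsingletons, so nothing is overridden). [folklore] -/
instance instDecidableEqIndex [DecidableEq G] : DecidableEq (Index L G) :=
  @instDecidableEqProd _ _ inferInstance inferInstance

/-- Two link configurations agree off the bond `b`: `k' = update k b (k' b)`, the relation under
which a one-link operator at `b` may have nonzero entries. [folklore] -/
theorem eq_update_iff (b : Bond L) (k k' : Bond L → G) :
    k' = Function.update k b (k' b) ↔ ∀ b', b' ≠ b → k' b' = k b' := by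
  rw [funext_iff]
  refine forall_congr' fun b' => ?_
  by_cases h : b' = b
  · subst h
    simp
  · simp [h]

/-- Agreement off `b` is symmetric. [folklore] -/
theorem eq_update_comm (b : Bond L) (k k' : Bond L → G) :
    k' = Function.update k b (k' b) ↔ k = Function.update k' b (k b) := by
  rw [eq_update_iff, eq_update_iff]
  exact ⟨fun h b' hb' => (h b' hb').symm, fun h b' hb' => (h b' hb').symm⟩

/-- **The electric operator `E_b` of the bond `b`** in the group-element basis: `E_b = 1 - P_b`,
`P_b` the averaging of the link variable `u_b` over `G`, i.e.
`⟨k| E_b |k'⟩ = [k, k' agree off b] (δ_{k_b, k'_b} - |G|⁻¹)` — the projector onto the link wave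
functions orthogonal to the constants in `u_b` (`= |G|⁻¹ Σ_{h∈G} (1 - L_h^{(b)})`, the kinetic energy
on the complete Cayley graph of `G`, all non-trivial irreducible representations at energy `1`; the
finite-group stand-in for the group Laplacian of Bietenholz–Wiese (2025) eq. (11.60)). [folklore] -/
def electricLink [Fintype G] [DecidableEq G] (b : Bond L) : Matrix (Bond L → G) (Bond L → G) ℂ :=
  Matrix.of fun k k' => if k' = Function.update k b (k' b) then
    (if k b = k' b then (1 : ℂ) else 0) - 1 / (Fintype.card G : ℂ) else 0

/-- Entries of `E_b`. [folklore] -/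
theorem electricLink_apply [Fintype G] [DecidableEq G] (b : Bond L) (k k' : Bond L → G) :
    electricLink L b k k' = if k' = Function.update k b (k' b) then
      (if k b = k' b then (1 : ℂ) else 0) - 1 / (Fintype.card G : ℂ) else 0 := rfl

/-- `E_b` is a real symmetric matrix: `star ⟨k'|E_b|k⟩ = ⟨k|E_b|k'⟩`. [folklore] -/
theorem star_electricLink_apply [Fintype G] [DecidableEq G] (b : Bond L) (k k' : Bond L → G) :
    star (electricLink L b k' k) = electricLink L b k k' := by
  rw [electricLink_apply, electricLink_apply]
  by_cases h : k' = Function.update k b (k' b)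
  · rw [if_pos h, if_pos ((eq_update_comm L b k k').1 h)]
    by_cases hb : k b = k' b
    · rw [if_pos hb, if_pos hb.symm, star_sub, star_one, star_div₀, star_one, Complex.star_def,
        Complex.conj_natCast]
    · rw [if_neg hb, if_neg (Ne.symm hb), star_sub, star_zero, star_div₀, star_one, Complex.star_def,
        Complex.conj_natCast]
  · rw [if_neg h, if_neg (fun h' => h ((eq_update_comm L b k k').2 h')), star_zero]

/-- `E_b` is Hermitian. [folklore] -/
theorem electricLink_isHermitian [Fintype G] [DecidableEq G] (b : Bond L) :
    (electricLink (G := G) L b).IsHermitian := by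
  ext k k'
  rw [conjTranspose_apply, star_electricLink_apply]

/-- The diagonal entry of `E_b` at the flat configuration (indeed at any configuration):
`⟨1|E_b|1⟩ = 1 - |G|⁻¹`. [folklore] -/
theorem electricLink_apply_self [Fintype G] [DecidableEq G] (b : Bond L) (k : Bond L → G) :
    electricLink L b k k = 1 - 1 / (Fintype.card G : ℂ) := by
  rw [electricLink_apply, if_pos (Function.update_eq_self b k).symm, if_pos rfl]

/-- **The electric energy `Σ_b E_b`** (number of excited links). Kogut–Susskind (1975);
Bietenholz–Wiese (2025) §11.8, eq. (11.62). [folklore] -/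
def electric [Fintype G] [DecidableEq G] : Matrix (Bond L → G) (Bond L → G) ℂ :=
  ∑ b : Bond L, electricLink L b

/-- The electric energy is Hermitian. [folklore] -/
theorem electric_isHermitian [Fintype G] [DecidableEq G] :
    (electric L : Matrix (Bond L → G) _ ℂ).IsHermitian := by
  rw [electric, IsHermitian, conjTranspose_sum]
  exact Finset.sum_congr rfl fun b _ => (electricLink_isHermitian L b).eq

/-- The diagonal entries of the electric energy: `⟨k| Σ_b E_b |k⟩ = |Bond L| (1 - |G|⁻¹)`.
[folklore] -/
theorem electric_apply_self [Fintype G] [DecidableEq G] (k : Bond L → G) :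
    electric L k k = (Fintype.card (Bond L) : ℂ) * (1 - 1 / (Fintype.card G : ℂ)) := by
  rw [electric, Matrix.sum_apply]
  simp only [electricLink_apply_self, Finset.sum_const, Finset.card_univ, nsmul_eq_mul]

/-- **The plaquette holonomy** based at `x`:
`hol_x(u) = u_{(x,0)} u_{(x+e₀,1)} u_{(x+e₁,0)}⁻¹ u_{(x,1)}⁻¹` (around the elementary square
`x → x+e₀ → x+e₀+e₁ → x+e₁ → x`). Bietenholz–Wiese (2025) §11.8, eq. (11.62). [folklore] -/
def holonomy [Group G] [NeZero L] (k : Bond L → G) (x : FermionTorus 2 L) : G :=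
  k (x, 0) * k (x.shift 0, 1) * (k (x.shift 1, 0))⁻¹ * (k (x, 1))⁻¹

/-- The flat configuration `u ≡ 1` has trivial holonomy. [folklore] -/
@[simp] theorem holonomy_one [Group G] [NeZero L] (x : FermionTorus 2 L) :
    holonomy L (1 : Bond L → G) x = 1 := by
  simp [holonomy]

end Links

/-! ### The representation-dependent pieces -/

section Rep

variable {G : Type*} [Group G] (ρ : G →* Matrix (Fin 2) (Fin 2) ℂ) (L : ℕ)

/-- **The gauge-covariant hopping** `Σ_{b=(x,i)} Σ_{σ,τ} c†_{xσ} c_{x+eᵢ,τ} ⊗ ρ(u_b)_{στ}` (one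
orientation; the Hamiltonian contains this plus its adjoint): the electron spinor is parallel
transported along the bond by `ρ(u_b)`. Kogut–Susskind (1975) (fermions coupled to link variables);
Fradkin–Shenker (1979) eq. (2.1) (matter–gauge coupling). [cite: KogutSusskind1975] -/
def hop [DecidableEq G] [NeZero L] : Matrix (Index L G) (Index L G) ℂ :=
  ∑ b : Bond L, ∑ σ : Fin 2, ∑ τ : Fin 2,
    (creation (orb b.1 σ) * annihilation (orb (b.1.shift b.2) τ)) ⊗ₖ
      (diagonal fun k : Bond L → G => ρ (k b) σ τ)

/-- **The magnetic weight of a holonomy**, `1 - ½ tr ρ(h)`, written as `1 - (ρ(h)₀₀ + ρ(h)₁₁)/2`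
(real for `ρ(h) ∈ SU(2)`; `0` iff `ρ(h) = 1` for a faithful `ρ`). Bietenholz–Wiese (2025) §11.8,
eq. (11.62) (`Tr(1 - ½ U_p - ½ U_p†)`). [folklore] -/
def plaquetteWeight (h : G) : ℂ := 1 - (ρ h 0 0 + ρ h 1 1) / 2

/-- `1 - ½ tr ρ(h)` in terms of `Matrix.trace`. [folklore] -/
theorem plaquetteWeight_eq_trace (h : G) : plaquetteWeight ρ h = 1 - (ρ h).trace / 2 := by
  rw [plaquetteWeight, Matrix.trace_fin_two]

/-- The trivial holonomy carries no magnetic energy. [folklore] -/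
@[simp] theorem plaquetteWeight_one : plaquetteWeight ρ (1 : G) = 0 := by
  rw [plaquetteWeight, map_one, Matrix.one_apply_eq, Matrix.one_apply_eq]
  norm_num

/-- **The magnetic energy** `Σ_p (1 - ½ tr ρ(hol_p))`, diagonal in the group-element basis.
Kogut–Susskind (1975); Bietenholz–Wiese (2025) §11.8, eq. (11.62). [folklore] -/
def magnetic [DecidableEq G] [NeZero L] : Matrix (Bond L → G) (Bond L → G) ℂ :=
  diagonal fun k => ∑ x : FermionTorus 2 L, plaquetteWeight ρ (holonomy L k x)

/-- The magnetic energy vanishes on the flat configuration `u ≡ 1`. [folklore] -/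
theorem magnetic_apply_one_one [DecidableEq G] [NeZero L] : magnetic ρ L 1 1 = 0 := by
  simp [magnetic]

/-- The magnetic energy is Hermitian when the characters `tr ρ(h)` are real (e.g. `ρ(G) ⊂ SU(2)`).
[folklore] -/
theorem magnetic_isHermitian [DecidableEq G] [NeZero L]
    (hρ : ∀ h : G, star (ρ h 0 0 + ρ h 1 1) = ρ h 0 0 + ρ h 1 1) :
    (magnetic ρ L).IsHermitian := by
  unfold magnetic
  refine isHermitian_diagonal_of_self_adjoint _ (funext fun k => ?_)
  rw [Pi.star_apply, star_sum]
  refine Finset.sum_congr rfl fun x _ => ?_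
  rw [plaquetteWeight, star_sub, star_one, star_div₀, hρ, star_ofNat]

/-- The matrix `(ε ρ(h))_{στ}` of the transported singlet, `ε = [[0,1],[-1,0]]`, written as in the
route: `(ε ρ)_{0τ} = ρ_{1τ}`, `(ε ρ)_{1τ} = -ρ_{0τ}`. [folklore] -/
def epsRep (h : G) (σ τ : Fin 2) : ℂ := if σ = 0 then ρ h 1 τ else -ρ h 0 τ

/-- `epsRep ρ h` is the matrix product `ε ρ(h)`. [folklore] -/
theorem epsRep_eq_eps_mul (h : G) (σ τ : Fin 2) : epsRep ρ h σ τ = (Q8.eps * ρ h) σ τ := by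
  rw [epsRep, Q8.eps, Matrix.mul_apply, Fin.sum_univ_two]
  fin_cases σ <;> simp

/-- At the identity, `(ε ρ(1))_{στ} = ε_{στ} = [σ = ↑][τ = ↓] - [σ = ↓][τ = ↑]`. [folklore] -/
theorem epsRep_one (σ τ : Fin 2) :
    epsRep ρ (1 : G) σ τ = if σ = 0 then (if τ = 1 then 1 else 0) else (if τ = 0 then -1 else 0) := by
  rw [epsRep, map_one]
  fin_cases σ <;> fin_cases τ <;> simp [Matrix.one_apply]

end Rep

section Blocks

variable {G : Type*} (L : ℕ)

/-- A basis state has particle number `N` (the route's block predicate `p`). [folklore] -/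
def HasParticleNumber (N : ℕ) (ik : Index L G) : Prop := ik.1.card = N

/-- The particle-number predicate is decidable. [folklore] -/
instance instDecidablePredHasParticleNumber (N : ℕ) :
    DecidablePred (HasParticleNumber (G := G) L N) :=
  fun ik => inferInstanceAs (Decidable (ik.1.card = N))

end Blocks

end SpinGauged

open SpinGauged

section Model

variable {G : Type*} [Group G] [Fintype G] [DecidableEq G]

/-- **The spin-gauged Hubbard torus with independent couplings**: for a finite group `G` with a
two-dimensional representation `ρ`,
`H = -Σ_{b,σ,τ} (c†_{xσ} c_{x+eᵢ,τ} ⊗ ρ(u_b)_{στ} + h.c.) + U Σ_x n_{x↑}n_{x↓} ⊗ 1 + gE · 1 ⊗ Σ_b E_b`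
`+ gB · 1 ⊗ Σ_p (1 - ½ tr ρ(hol_p))` on `SpinGauged.Index L G` (hopping amplitude `1`): the
Kogut–Susskind Hamiltonian of the gauge group `G` in the group-element basis, minimally coupled to
the SPIN of the Hubbard electrons. Kogut–Susskind (1975); Bietenholz–Wiese (2025) §11.8
eq. (11.62); Fradkin–Shenker (1979). [cite: BietenholzWiese2025, §11.8 eq. (11.62)] -/
def spinGaugedHubbardTorusWith (ρ : G →* Matrix (Fin 2) (Fin 2) ℂ) (L : ℕ) [NeZero L]
    (U gE gB : ℝ) : Matrix (Index L G) (Index L G) ℂ :=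
  -(hop ρ L + (hop ρ L)ᴴ) +
    (U : ℂ) • ((∑ x : FermionTorus 2 L, numberOp x 0 * numberOp x 1) ⊗ₖ
      (1 : Matrix (Bond L → G) (Bond L → G) ℂ)) +
    (gE : ℂ) • ((1 : Matrix (Finset (Orb (FermionTorus 2 L))) _ ℂ) ⊗ₖ electric L) +
    (gB : ℂ) • ((1 : Matrix (Finset (Orb (FermionTorus 2 L))) _ ℂ) ⊗ₖ magnetic ρ L)

/-- **The `Q₈`-spin-gauged Hubbard torus `H_g(L, U)`** of route ColourTheSpin: the Hubbard torus
`hubbardTorus 2 L 1 U` with its electron spin minimally coupled to a `Q₈` Kogut–Susskind gauge field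
of coupling `g` (electric weight `g²`, magnetic weight `g⁻²`), i.e.
`spinGaugedHubbardTorusWith Q8.rep L U (g ^ 2) (1 / g ^ 2)`; `g = 0` is a junk value (`1/0 = 0`).
Definitionally the `let H` inlined in the route items (`spinGaugedHubbardTorus_eq_inline`).
Kogut–Susskind (1975); Bietenholz–Wiese (2025) §11.8 eq. (11.62). [cite: KogutSusskind1975] -/
def spinGaugedHubbardTorus (L : ℕ) [NeZero L] (U g : ℝ) : Matrix (Index L Q8) (Index L Q8) ℂ :=
  spinGaugedHubbardTorusWith Q8.rep L U (g ^ 2) (1 / g ^ 2)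

/-- **The transported `B₁g` (d_{x²-y²}) singlet pair field**
`Δ_d^g = Σ_{b=(x,i)} g_d(i) Σ_{σ,τ} (ε ρ(u_b))_{στ} c_{xσ} c_{x+eᵢ,τ} ⊗ |u⟩⟨u|`, `g_d(0) = 1`,
`g_d(1) = -1`: the bond singlet with the second electron's spinor parallel transported to `x`, a
GAUGE-INVARIANT local operator (for `ρ(G) ⊂ SU(2)`, `ρᵀ ε ρ = ε`). At `u ≡ 1` it is the summit's
`pairField dWaveFormFactor L / √2` (`spinGaugedPairFieldWith_apply_one_one`).
Scalapino (1995) §2 eqs. (2.2)–(2.3) (the `d`-wave pair field); Fradkin–Shenker (1979) (gauge-invariant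
composites). [folklore] -/
def spinGaugedPairFieldWith (ρ : G →* Matrix (Fin 2) (Fin 2) ℂ) (L : ℕ) [NeZero L] :
    Matrix (Index L G) (Index L G) ℂ :=
  ∑ b : Bond L, (if b.2 = 0 then (1 : ℂ) else -1) • ∑ σ : Fin 2, ∑ τ : Fin 2,
    (annihilation (orb b.1 σ) * annihilation (orb (b.1.shift b.2) τ)) ⊗ₖ
      (diagonal fun k : Bond L → G => epsRep ρ (k b) σ τ)

/-- **The `Q₈`-transported `B₁g` pair field `Δ_d^g`** of route ColourTheSpin
(`spinGaugedPairFieldWith Q8.rep L`); definitionally the route's `let P`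
(`spinGaugedPairField_eq_inline`). Scalapino (1995) §2. [folklore] -/
def spinGaugedPairField (L : ℕ) [NeZero L] : Matrix (Index L Q8) (Index L Q8) ℂ :=
  spinGaugedPairFieldWith Q8.rep L

end Model

/-! ### The inlined route text -/

section Inline

variable (L : ℕ) [NeZero L]

/-- `spinGaugedHubbardTorus L U g` is, by `rfl`, the `let`-expression `H` inlined verbatim in the
items `SgCorridorOrder`, `SgEndpoint`, `SgAnchorOrder`, `SgHoppingDictionary` of route
`HubbardSuperconductivity/ColourTheSpin` (so those items can be restated over it with
`show`/`change`). [folklore] -/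
theorem spinGaugedHubbardTorus_eq_inline (U g : ℝ) :
    spinGaugedHubbardTorus L U g =
      (let m : Fin 2 × ZMod 4 → Fin 2 × ZMod 4 → Fin 2 × ZMod 4 := fun u v =>
        (u.1 + v.1, if u.1 = 0 then (if v.1 = 0 then u.2 + v.2 else v.2 - u.2)
          else if v.1 = 0 then u.2 + v.2 else 2 + v.2 - u.2)
      let iv : Fin 2 × ZMod 4 → Fin 2 × ZMod 4 := fun u => (u.1, if u.1 = 0 then -u.2 else u.2 + 2)
      let r : Fin 2 × ZMod 4 → Fin 2 → Fin 2 → ℂ := fun u σ τ =>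
        if u.1 = 0 then (if σ = τ then (if σ = 0 then Complex.I else -Complex.I) ^ u.2.val else 0)
        else if σ = τ then 0 else if σ = 0 then -(-Complex.I) ^ u.2.val else Complex.I ^ u.2.val
      let hop := ∑ b : GaugedHubbard.Bond L, ∑ σ : Fin 2, ∑ τ : Fin 2,
        Matrix.kroneckerMap (· * ·) (creation (orb b.1 σ) * annihilation (orb (b.1.shift b.2) τ))
          (Matrix.diagonal fun k : GaugedHubbard.Bond L → Fin 2 × ZMod 4 => r (k b) σ τ)
      let H := -(hop + hopᴴ) +
        ((U : ℝ) : ℂ) • Matrix.kroneckerMap (· * ·)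
          (∑ x : FermionTorus 2 L, numberOp x 0 * numberOp x 1)
          (1 : Matrix (GaugedHubbard.Bond L → Fin 2 × ZMod 4)
            (GaugedHubbard.Bond L → Fin 2 × ZMod 4) ℂ) +
        ((g ^ 2 : ℝ) : ℂ) • Matrix.kroneckerMap (· * ·)
          (1 : Matrix (Finset (Orb (FermionTorus 2 L))) _ ℂ)
          (∑ b : GaugedHubbard.Bond L, Matrix.of fun k k' : GaugedHubbard.Bond L → Fin 2 × ZMod 4 =>
            if k' = Function.update k b (k' b) then (if k b = k' b then (1 : ℂ) else 0) - 1 / 8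
            else 0) +
        ((1 / g ^ 2 : ℝ) : ℂ) • Matrix.kroneckerMap (· * ·)
          (1 : Matrix (Finset (Orb (FermionTorus 2 L))) _ ℂ)
          (Matrix.diagonal fun k : GaugedHubbard.Bond L → Fin 2 × ZMod 4 =>
            ∑ x : FermionTorus 2 L,
              (1 - (r (m (m (m (k (x, 0)) (k (x.shift 0, 1))) (iv (k (x.shift 1, 0)))) (iv (k (x, 1))))
                0 0 +
                r (m (m (m (k (x, 0)) (k (x.shift 0, 1))) (iv (k (x.shift 1, 0)))) (iv (k (x, 1))))
                1 1) / 2))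
      H) := by
  dsimp only [spinGaugedHubbardTorus, spinGaugedHubbardTorusWith, SpinGauged.hop, SpinGauged.electric,
    SpinGauged.electricLink, SpinGauged.magnetic, SpinGauged.plaquetteWeight, SpinGauged.holonomy,
    Q8.rep_apply, Q8.mul_def, Q8.inv_def, Q8.card, Nat.cast_ofNat]
  rfl

/-- `spinGaugedPairField L` is, by `rfl`, the `let`-expression `P` inlined verbatim in the items
`SgCorridorOrder`, `SgEndpoint`, `SgAnchorOrder`, `SgPairDictionary` of route ColourTheSpin.
[folklore] -/
theorem spinGaugedPairField_eq_inline :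
    spinGaugedPairField L =
      (let r : Fin 2 × ZMod 4 → Fin 2 → Fin 2 → ℂ := fun u σ τ =>
        if u.1 = 0 then (if σ = τ then (if σ = 0 then Complex.I else -Complex.I) ^ u.2.val else 0)
        else if σ = τ then 0 else if σ = 0 then -(-Complex.I) ^ u.2.val else Complex.I ^ u.2.val
      let P := ∑ b : GaugedHubbard.Bond L, (if b.2 = 0 then (1 : ℂ) else -1) •
        ∑ σ : Fin 2, ∑ τ : Fin 2,
          Matrix.kroneckerMap (· * ·)
            (annihilation (orb b.1 σ) * annihilation (orb (b.1.shift b.2) τ))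
            (Matrix.diagonal fun k : GaugedHubbard.Bond L → Fin 2 × ZMod 4 =>
              if σ = 0 then r (k b) 1 τ else -r (k b) 0 τ)
      P) := by
  dsimp only [spinGaugedPairField, spinGaugedPairFieldWith, SpinGauged.epsRep, Q8.rep_apply]
  rfl

end Inline

/-- The route's block predicate `p ik ↔ ik.1.card = N` is `HasParticleNumber` (definitional).
[folklore] -/
theorem hasParticleNumber_iff (L N : ℕ) (ik : Index L Q8) :
    HasParticleNumber L N ik ↔ ik.1.card = N := Iff.rfl

/-- The flat `Q₈` configuration is the constant function `(0, 0)` of the route text (definitional).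
[folklore] -/
theorem one_eq_const_zero (L : ℕ) : (1 : Bond L → Q8) = fun _ => ((0 : Fin 2), (0 : ZMod 4)) := rfl

/-! ### Hermiticity -/

section Hermitian

variable {G : Type*} [Group G] [Fintype G] [DecidableEq G] (ρ : G →* Matrix (Fin 2) (Fin 2) ℂ)
  (L : ℕ) [NeZero L]

/-- **The spin-gauged Hubbard torus is Hermitian** whenever the characters `tr ρ(h)` are real
(automatic for `ρ(G) ⊂ SU(2)`). Kogut–Susskind (1975). [folklore] -/
theorem isHermitian_spinGaugedHubbardTorusWith
    (hρ : ∀ h : G, star (ρ h 0 0 + ρ h 1 1) = ρ h 0 0 + ρ h 1 1) (U gE gB : ℝ) :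
    (spinGaugedHubbardTorusWith ρ L U gE gB).IsHermitian := by
  unfold spinGaugedHubbardTorusWith
  refine ((IsHermitian.add ?_ ?_).add ?_).add ?_
  · exact (isHermitian_add_transpose_self _).neg
  · exact isHermitian_real_smul U
      (isHermitian_kronecker (isHermitian_sum_numberOp_mul L) isHermitian_one)
  · exact isHermitian_real_smul gE (isHermitian_kronecker isHermitian_one (electric_isHermitian L))
  · exact isHermitian_real_smul gB
      (isHermitian_kronecker isHermitian_one (magnetic_isHermitian ρ L hρ))

/-- **`H_g(L, U)` is Hermitian** (the characters of `Q₈ ⊂ SU(2)` are real). Kogut–Susskind (1975).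
[folklore] -/
theorem isHermitian_spinGaugedHubbardTorus (U g : ℝ) : (spinGaugedHubbardTorus L U g).IsHermitian :=
  isHermitian_spinGaugedHubbardTorusWith Q8.rep L Q8.star_trace_rep U _ _

end Hermitian

/-! ### The trivial-link dictionary -/

section Dictionary

variable {G : Type*} [Group G] [DecidableEq G] (ρ : G →* Matrix (Fin 2) (Fin 2) ℂ) (L : ℕ) [NeZero L]

/-- At the flat configuration the hopping block is the ordinary forward hopping:
`⟨s, 1| hop |s', 1⟩ = Σ_{b,σ} ⟨s| c†_{xσ} c_{x+eᵢ,σ} |s'⟩` (`ρ(1) = 1`). [folklore] -/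
theorem hop_apply_one_one (s s' : Finset (Orb (FermionTorus 2 L))) :
    hop ρ L (s, 1) (s', 1) = ∑ b : Bond L, ∑ σ : Fin 2,
      (creation (orb b.1 σ) * annihilation (orb (b.1.shift b.2) σ)) s s' := by
  simp only [hop, Matrix.sum_apply, kroneckerMap_apply, diagonal_apply_eq, Pi.one_apply, map_one,
    Matrix.one_apply, mul_ite, mul_one, mul_zero, Finset.sum_ite_eq, Finset.mem_univ, if_true]

/-- At the flat configuration the adjoint hopping block is the backward hopping:
`⟨s, 1| hopᴴ |s', 1⟩ = Σ_{b,σ} ⟨s| c†_{x+eᵢ,σ} c_{xσ} |s'⟩`. [folklore] -/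
theorem hop_conjTranspose_apply_one_one (s s' : Finset (Orb (FermionTorus 2 L))) :
    (hop ρ L)ᴴ (s, 1) (s', 1) = ∑ b : Bond L, ∑ σ : Fin 2,
      (creation (orb (b.1.shift b.2) σ) * annihilation (orb b.1 σ)) s s' := by
  rw [conjTranspose_apply, hop_apply_one_one, star_sum]
  refine Finset.sum_congr rfl fun b _ => ?_
  rw [star_sum]
  refine Finset.sum_congr rfl fun σ _ => ?_
  rw [← conjTranspose_apply, conjTranspose_mul, creation_conjTranspose, annihilation_conjTranspose]

/-- **Neighbour enumeration**: for `L ≥ 3` the forward plus backward bond hoppings are the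
Hubbard hopping over ordered adjacent pairs of `fermionTorusGraph 2 L`. [folklore] -/
theorem sum_bond_hopping_add (hL : 3 ≤ L) :
    ((∑ b : Bond L, ∑ σ : Fin 2, creation (orb b.1 σ) * annihilation (orb (b.1.shift b.2) σ)) +
      ∑ b : Bond L, ∑ σ : Fin 2, creation (orb (b.1.shift b.2) σ) * annihilation (orb b.1 σ) :
        Matrix (Finset (Orb (FermionTorus 2 L))) _ ℂ) =
      ∑ x : FermionTorus 2 L, ∑ y : FermionTorus 2 L, ∑ σ : Fin 2,
        if (fermionTorusGraph 2 L).Adj x y then creation (orb x σ) * annihilation (orb y σ) else 0 := by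
  have h := FermionTorus.sum_shift_add_sum_shift_swap hL
    (fun x y : FermionTorus 2 L => ∑ σ : Fin 2, (creation (orb x σ) * annihilation (orb y σ) :
      Matrix (Finset (Orb (FermionTorus 2 L))) _ ℂ))
  simp only [Finset.sum_add_distrib] at h
  rw [Fintype.sum_prod_type, Fintype.sum_prod_type, h]
  refine Finset.sum_congr rfl fun x _ => Finset.sum_congr rfl fun y _ => ?_
  split_ifs <;> simp

/-- **The trivial-link dictionary for the Hamiltonian** (`L ≥ 3`): the diagonal link block of `H` at
the flat configuration `u ≡ 1` is the summit's Hubbard Hamiltonian plus the constant electric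
energy, `⟨s, 1| H |s', 1⟩ = ⟨s| hubbardTorus 2 L 1 U |s'⟩ + δ_{ss'} · gE |Bond L| (1 - |G|⁻¹)`
(`ρ(1) = 1` in the hopping, zero magnetic weight on the flat configuration). [folklore] -/
theorem spinGaugedHubbardTorusWith_apply_one_one [Fintype G] (hL : 3 ≤ L) (U gE gB : ℝ)
    (s s' : Finset (Orb (FermionTorus 2 L))) :
    spinGaugedHubbardTorusWith ρ L U gE gB (s, 1) (s', 1) =
      hubbardTorus 2 L 1 U s s' +
        (if s = s' then (gE : ℂ) * ((Fintype.card (Bond L) : ℂ) * (1 - 1 / (Fintype.card G : ℂ)))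
          else 0) := by
  have hhop : (-(hop ρ L + (hop ρ L)ᴴ)) (s, 1) (s', 1) =
      (-(∑ x : FermionTorus 2 L, ∑ y : FermionTorus 2 L, ∑ σ : Fin 2,
        if (fermionTorusGraph 2 L).Adj x y then creation (orb x σ) * annihilation (orb y σ) else 0 :
          Matrix (Finset (Orb (FermionTorus 2 L))) _ ℂ)) s s' := by
    rw [Matrix.neg_apply, Matrix.add_apply, hop_apply_one_one, hop_conjTranspose_apply_one_one,
      Matrix.neg_apply, ← sum_bond_hopping_add L hL, Matrix.add_apply, Matrix.sum_apply,
      Matrix.sum_apply]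
    simp only [Matrix.sum_apply]
  rw [spinGaugedHubbardTorusWith, Matrix.add_apply, Matrix.add_apply, Matrix.add_apply, hhop,
    hubbardTorus, hamiltonian]
  simp only [Matrix.smul_apply, kroneckerMap_apply, Matrix.one_apply_eq, mul_one,
    electric_apply_self, magnetic_apply_one_one, mul_zero, add_zero, Matrix.add_apply,
    Matrix.neg_apply, Complex.ofReal_one, neg_smul, one_smul, smul_eq_mul, Matrix.one_apply]
  split_ifs <;> simp

/-- **Route item `SgHoppingDictionary`, literature form** (`L ≥ 3`):
`⟨s, 1| H_g(L,U) |s', 1⟩ = ⟨s| hubbardTorus 2 L 1 U |s'⟩ + δ_{ss'} (7/8) g² |Bond L|`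
(`E_b(1,1) = 1 - 1/8` on each of the `|Bond L| = 2L²` bonds, zero magnetic weight). [folklore] -/
theorem spinGaugedHubbardTorus_apply_one_one (hL : 3 ≤ L) (U g : ℝ)
    (s s' : Finset (Orb (FermionTorus 2 L))) :
    spinGaugedHubbardTorus L U g (s, 1) (s', 1) =
      hubbardTorus 2 L 1 U s s' +
        (if s = s' then (((7 : ℝ) / 8 * g ^ 2 * (Fintype.card (Bond L) : ℝ) : ℝ) : ℂ) else 0) := by
  rw [spinGaugedHubbardTorus, spinGaugedHubbardTorusWith_apply_one_one Q8.rep L hL, Q8.card]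
  congr 1
  split_ifs
  · push_cast
    ring
  · rfl

/-- `x̄ + eᵢ` on `(ℤ/Lℤ)²` is the forward shift on the fermionic torus:
`ofTorusSite (x̄ + eᵢ) = shift (ofTorusSite x̄) i`. [folklore] -/
theorem FermionTorus.ofTorusSite_add_single (z : TorusSite 2 L) (i : Fin 2) :
    FermionTorus.ofTorusSite (z + Pi.single i 1) = (FermionTorus.ofTorusSite z : FermionTorus 2 L).shift i :=
  FermionTorus.toTorusSite_injective (by
    rw [FermionTorus.toTorusSite_ofTorusSite, FermionTorus.toTorusSite_shift,
      FermionTorus.toTorusSite_ofTorusSite])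

/-- At the flat configuration the transported pair field is the bare directed-bond `d`-wave pair
field: `⟨s, 1| Δ_d^g |s', 1⟩ = ⟨s| Σ_x b_{x,0} - Σ_x b_{x,1} |s'⟩`,
`b_{x,i} = c_{x↑}c_{x+eᵢ,↓} - c_{x↓}c_{x+eᵢ,↑}` (`ε ρ(1) = ε`). [folklore] -/
theorem spinGaugedPairFieldWith_apply_one_one_eq_torusBondPair (s s' : Finset (Orb (FermionTorus 2 L))) :
    spinGaugedPairFieldWith ρ L (s, 1) (s', 1) =
      (∑ z : TorusSite 2 L, torusBondPair L z 0 - ∑ z : TorusSite 2 L, torusBondPair L z 1) s s' := by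
  -- entries at the flat configuration: only `(σ, τ) = (↑, ↓)` and `(↓, ↑)` survive
  have hστ : ∀ b : Bond L, (∑ σ : Fin 2, ∑ τ : Fin 2,
      ((annihilation (orb b.1 σ) * annihilation (orb (b.1.shift b.2) τ)) ⊗ₖ
        (diagonal fun k : Bond L → G => epsRep ρ (k b) σ τ))) (s, 1) (s', 1) =
      (annihilation (orb b.1 0) * annihilation (orb (b.1.shift b.2) 1) -
        annihilation (orb b.1 1) * annihilation (orb (b.1.shift b.2) 0)) s s' := by
    intro b
    simp only [Matrix.sum_apply, Fin.sum_univ_two, Matrix.add_apply, kroneckerMap_apply,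
      diagonal_apply_eq, Pi.one_apply, epsRep_one, Fin.isValue, Matrix.sub_apply, if_true,
      one_ne_zero, if_false, zero_ne_one, mul_one, mul_zero, mul_neg, add_zero, zero_add]
    ring
  -- the bond sum as a sum over `(ℤ/Lℤ)²`
  have hbond : ∀ i : Fin 2, (∑ x : FermionTorus 2 L,
      (annihilation (orb x 0) * annihilation (orb (x.shift i) 1) -
        annihilation (orb x 1) * annihilation (orb (x.shift i) 0) :
          Matrix (Finset (Orb (FermionTorus 2 L))) _ ℂ)) =
      ∑ z : TorusSite 2 L, torusBondPair L z i := by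
    intro i
    rw [FermionTorus.sum_eq_sum_torusSite]
    refine Finset.sum_congr rfl fun z _ => ?_
    rw [torusBondPair, FermionTorus.ofTorusSite_add_single]
  unfold spinGaugedPairFieldWith
  rw [Matrix.sum_apply]
  simp only [Matrix.smul_apply, hστ, smul_eq_mul]
  rw [Fintype.sum_prod_type]
  simp only [Fin.sum_univ_two, Fin.isValue, if_true, one_ne_zero, if_false, one_mul, neg_one_mul,
    Finset.sum_add_distrib, Finset.sum_neg_distrib]
  rw [← Matrix.sum_apply, ← Matrix.sum_apply, hbond 0, hbond 1, Matrix.sub_apply, sub_eq_add_neg]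

/-- **The trivial-link dictionary for the pair field** (every `L ≥ 1`, every `ρ`): at `u ≡ 1` the
transported `B₁g` pair field is the summit's pair field divided by `√2`,
`⟨s, 1| Δ_d^g |s', 1⟩ = (√2)⁻¹ ⟨s| pairField dWaveFormFactor L |s'⟩` (each bond counted once here,
twice with weight `1/√2` in `localPair`). Scalapino (1995) §2 eqs. (2.2)–(2.3). [folklore] -/
theorem spinGaugedPairFieldWith_apply_one_one (s s' : Finset (Orb (FermionTorus 2 L))) :
    spinGaugedPairFieldWith ρ L (s, 1) (s', 1) =
      (((Real.sqrt 2)⁻¹ : ℝ) : ℂ) * pairField dWaveFormFactor L s s' := by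
  rw [spinGaugedPairFieldWith_apply_one_one_eq_torusBondPair, pairField_dWaveFormFactor_eq,
    Matrix.smul_apply, smul_eq_mul, ← mul_assoc, ← Complex.ofReal_mul,
    inv_mul_cancel₀ (Real.sqrt_ne_zero'.2 two_pos), Complex.ofReal_one, one_mul]

/-- **Route item `SgPairDictionary`, literature form**: for `Q₈` and every `L ≥ 1`,
`⟨s, 1| Δ_d^g |s', 1⟩ = (√2)⁻¹ ⟨s| pairField dWaveFormFactor L |s'⟩`. Scalapino (1995) §2.
[folklore] -/
theorem spinGaugedPairField_apply_one_one (s s' : Finset (Orb (FermionTorus 2 L))) :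
    spinGaugedPairField L (s, 1) (s', 1) =
      (((Real.sqrt 2)⁻¹ : ℝ) : ℂ) * pairField dWaveFormFactor L s s' :=
  spinGaugedPairFieldWith_apply_one_one Q8.rep L s s'

end Dictionary

end Literature.MathematicalPhysics.QuantumLattice
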